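import Mathlib
import Literature.NumberTheory.Irrationality.CressonFischlerRivoal2008.WellPoisedSymmetry
import Literature.NumberTheory.Irrationality.Zudilin2002.WellPoisedIntegrals
import HarnessLib

/-!
# Integer very-well-poised `F₇(h)` is a `ℚ`-form in `1, ζ(3), ζ(5)` — PROVED from the tree's CFR Théorème 1

HONEST FRAMING (cell pub-zeta5): systematic search; no irrationality claim unless certified.

`Zudilin2002.vwpSeries 7 h = F₇(h₀; h₁,…,h₇) = Σ_{μ≥0} (h₀+2μ) ∏_{j=0}^{7} Γ(h_j+μ)/Γ(1+h₀-h_j+μ)` (the sign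
`(-1)^{8μ} = 1`) is the very-well-poised hypergeometric series that Zudilin's Theorem 5 ([Zudilin2002VWPIntegrals],
`k = 5`; tree fact `vwp_eq_integral_of_pos`) equates, up to a Γ-factor, with Sorokin/Beukers-type integrals `J₅` on
the very-well-poised locus `L₅` (FAMILY.md 17d of the cell).  The arithmetic half — for INTEGER parameters the series is
a rational linear form in `1, ζ(3), ζ(5)` — is the Ball–Rivoal lemma; the tree PROVES the general statement behind it:
`CressonFischlerRivoal2008.theoreme1_holds` (Théorème 1 of Cresson–Fischler–Rivoal: `Σ_{k≥1} P(k)/(k)_{n+1}^A ∈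
ℚ + Σ_{3≤s≤A, s odd} ℚζ(s)` for `deg P ≤ A(n+1)-2`, `P(-n-X) = (-1)^{A(n+1)+1}P(X)`).

THIS FILE (sorry-free) derives from that theorem:

**`vwpSeries_seven_odd`**: for `h : ℕ → ℕ` with `h 0 ≥ 2`, `1 ≤ h j ≤ h 0` (`1 ≤ j ≤ 7`) and
`h 1 + ⋯ + h 7 ≤ 3·h 0 + 2` (exactly the convergence range of the series; wider than the standing range (8.1)
`≤ 3h₀` of [Zudilin2004], which is what the cell needs: the residual raw `L₅` terms of FAMILY 17d have
`3h₀ < Σh_j ≤ 3h₀+2`, e.g. Sorokin's own `J₅(1;1⁵|2⁵)`, `h = (2;1,…,1)`), there are rationals `c₀,c₁,c₂` with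
`vwpSeries 7 h = c₀ + c₁ζ(3) + c₂ζ(5)`.

Dictionary to Théorème 1: `n = h₀-2`, `A = 6`, `P(X) = (2X+n)·∏_{j=1}^{7} Q_j(X)`,
`Q_j(X) = ∏_{i<h_j-1}(X+i) · ∏_{i<h_j-1}(X+(h₀-h_j)+i)` (`qFactor`), via the termwise identity (`μ ≥ 0`)
`(h₀+2μ)∏_{j=0}^{7}Γ(h_j+μ)/Γ(1+h₀-h_j+μ) = P(μ+1)/(μ+1)_{n+1}^6` (`vwpTerm_eq`: Γ at positive integers = factorials),
the symmetry `Q_j(-n-X) = Q_j(X)`, `(2X+n) ↦ -(2X+n)` with `A(n+1)` even (`vwpPoly_comp_neg`), and the degree count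
`deg P ≤ 2Σh_j - 13 ≤ 6(n+1) - 2 ⟺ Σh_j ≤ 3h₀+2` (`natDegree_vwpPoly`).  Used by `SorokinCensus/RawLocusOddProof.lean`.
-/

noncomputable section

namespace Summit.KontsevichZagierPeriods.Zeta5Search.SorokinCensus

open Literature.NumberTheory.Irrationality.CressonFischlerRivoal2008 (poch theoreme1 theoreme1_holds)
open Literature.NumberTheory.Irrationality.Zudilin2002 (vwpSeries)
open Literature.NumberTheory.Transcendental (zetaValue)
open Finset Polynomial

/-! ### Small finite sums and products -/

/-- `Σ_{j=1}^{7} f j`, expanded. -/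
theorem sum_Icc_one_seven {M : Type*} [AddCommMonoid M] (f : ℕ → M) :
    ∑ j ∈ Finset.Icc 1 7, f j = f 1 + f 2 + f 3 + f 4 + f 5 + f 6 + f 7 := by
  have : Finset.Icc 1 7 = {1, 2, 3, 4, 5, 6, 7} := by
    ext j; simp only [Finset.mem_Icc, Finset.mem_insert, Finset.mem_singleton]; omega
  rw [this, Finset.sum_insert (by decide), Finset.sum_insert (by decide), Finset.sum_insert (by decide),
    Finset.sum_insert (by decide), Finset.sum_insert (by decide), Finset.sum_insert (by decide), Finset.sum_singleton]
  simp only [add_assoc]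

/-- `∏_{j=1}^{7} f j`, expanded. -/
theorem prod_Icc_one_seven {M : Type*} [CommMonoid M] (f : ℕ → M) :
    ∏ j ∈ Finset.Icc 1 7, f j = f 1 * f 2 * f 3 * f 4 * f 5 * f 6 * f 7 := by
  have : Finset.Icc 1 7 = {1, 2, 3, 4, 5, 6, 7} := by
    ext j; simp only [Finset.mem_Icc, Finset.mem_insert, Finset.mem_singleton]; omega
  rw [this, Finset.prod_insert (by decide), Finset.prod_insert (by decide), Finset.prod_insert (by decide),
    Finset.prod_insert (by decide), Finset.prod_insert (by decide), Finset.prod_insert (by decide), Finset.prod_singleton]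
  simp only [mul_assoc]

/-- `∏_{j<8} f j = f 0 · ∏_{j=1}^{7} f j`. -/
theorem prod_range_eight {M : Type*} [CommMonoid M] (f : ℕ → M) :
    ∏ j ∈ Finset.range (7 + 1), f j = f 0 * ∏ j ∈ Finset.Icc 1 7, f j := by
  rw [prod_Icc_one_seven]
  simp only [Finset.prod_range_succ, Finset.prod_range_zero, one_mul, Nat.reduceAdd]
  simp only [mul_assoc]

/-! ### The polynomial `P` of the dictionary -/

/-- The rising block `∏_{i<m} (X + (s+i))`. -/
def risingPoly (s m : ℕ) : ℚ[X] := ∏ i ∈ Finset.range m, (X + C ((s + i : ℕ) : ℚ))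

/-- `Q_k(X) = ∏_{i<k-1}(X+i) · ∏_{i<k-1}(X+(n+2-k)+i)` (`n = h₀-2`, `k = h_j`). -/
def qFactor (n k : ℕ) : ℚ[X] := risingPoly 0 (k - 1) * risingPoly (n + 2 - k) (k - 1)

/-- `P(X) = (2X+n) · ∏_{j=1}^{7} Q_{h_j}(X)` (`n = h₀-2`). -/
def vwpPoly (n : ℕ) (h : ℕ → ℕ) : ℚ[X] := (C 2 * X + C (n : ℚ)) * ∏ j ∈ Finset.Icc 1 7, qFactor n (h j)

/-- Evaluation of a rising block at a real point. -/
theorem aeval_risingPoly (s m : ℕ) (x : ℝ) :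
    aeval x (risingPoly s m) = ∏ i ∈ Finset.range m, (x + ((s + i : ℕ) : ℝ)) := by
  simp only [risingPoly, map_prod, map_add, Polynomial.aeval_X, Polynomial.aeval_C, eq_ratCast, Rat.cast_natCast]

/-- Degree of a rising block. -/
theorem natDegree_risingPoly_le (s m : ℕ) : (risingPoly s m).natDegree ≤ m := by
  unfold risingPoly
  refine (Polynomial.natDegree_prod_le _ _).trans ?_
  refine (Finset.sum_le_sum fun i _ => (natDegree_X_add_C _).le).trans ?_
  simp

/-- Degree of `Q_k`. -/
theorem natDegree_qFactor_le (n k : ℕ) : (qFactor n k).natDegree ≤ 2 * (k - 1) := by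
  unfold qFactor
  refine Polynomial.natDegree_mul_le.trans ?_
  have h1 := natDegree_risingPoly_le 0 (k - 1)
  have h2 := natDegree_risingPoly_le (n + 2 - k) (k - 1)
  omega

/-- A rising block under `X ↦ -n-X`: `∏_{i<m}(-n-X+s+i) = (-1)^m ∏_{i<m}(X+(n+1-s-m)+i)` (`s + m ≤ n + 1`). -/
theorem risingPoly_comp_neg (s m n : ℕ) (hsm : s + m ≤ n + 1) :
    (risingPoly s m).comp (-(n : ℚ[X]) - X) = (-1 : ℚ[X]) ^ m * risingPoly (n + 1 - s - m) m := by
  unfold risingPoly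
  rw [Polynomial.prod_comp]
  have hterm : ∀ i ∈ Finset.range m, (X + C ((s + i : ℕ) : ℚ)).comp (-(n : ℚ[X]) - X) =
      (-1 : ℚ[X]) * (X + C (((n + 1 - s - m) + (m - 1 - i) : ℕ) : ℚ)) := by
    intro i hi
    rw [Finset.mem_range] at hi
    have ht : ((n : ℕ) : ℚ) = ((s + i : ℕ) : ℚ) + (((n + 1 - s - m) + (m - 1 - i) : ℕ) : ℚ) := by
      norm_cast; omega
    simp only [add_comp, X_comp, C_comp]
    rw [← C_eq_natCast, ht, C_add]
    ring
  rw [Finset.prod_congr rfl hterm, Finset.prod_mul_distrib, Finset.prod_const, Finset.card_range]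
  congr 1
  exact Finset.prod_range_reflect (fun i => X + C (((n + 1 - s - m) + i : ℕ) : ℚ)) m

/-- `Q_k(-n-X) = Q_k(X)` for `1 ≤ k ≤ n+2`. -/
theorem qFactor_comp_neg (n k : ℕ) (hk1 : 1 ≤ k) (hk2 : k ≤ n + 2) :
    (qFactor n k).comp (-(n : ℚ[X]) - X) = qFactor n k := by
  unfold qFactor
  rw [mul_comp, risingPoly_comp_neg 0 (k - 1) n (by omega), risingPoly_comp_neg (n + 2 - k) (k - 1) n (by omega),
    show n + 1 - 0 - (k - 1) = n + 2 - k by omega, show n + 1 - (n + 2 - k) - (k - 1) = 0 by omega]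
  calc (-1 : ℚ[X]) ^ (k - 1) * risingPoly (n + 2 - k) (k - 1) * ((-1) ^ (k - 1) * risingPoly 0 (k - 1))
      = ((-1 : ℚ[X]) * (-1)) ^ (k - 1) * (risingPoly 0 (k - 1) * risingPoly (n + 2 - k) (k - 1)) := by
        rw [mul_pow]; ring
    _ = risingPoly 0 (k - 1) * risingPoly (n + 2 - k) (k - 1) := by
        rw [neg_mul_neg, one_mul, one_pow, one_mul]

/-- SYMMETRY of `P`: `P(-n-X) = (-1)^{6(n+1)+1} P(X)` (the hypothesis of CFR Théorème 1 with `A = 6`). -/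
theorem vwpPoly_comp_neg (n : ℕ) (h : ℕ → ℕ) (hb : ∀ j ∈ Finset.Icc 1 7, 1 ≤ h j ∧ h j ≤ n + 2) :
    (vwpPoly n h).comp (-(n : ℚ[X]) - X) = (-1 : ℚ[X]) ^ (6 * (n + 1) + 1) * vwpPoly n h := by
  have hlin : (C (2 : ℚ) * X + C (n : ℚ)).comp (-(n : ℚ[X]) - X) = -(C (2 : ℚ) * X + C (n : ℚ)) := by
    simp only [add_comp, mul_comp, C_comp, X_comp]
    rw [← C_eq_natCast]
    simp only [map_ofNat]
    ring
  have hprod : (∏ j ∈ Finset.Icc 1 7, qFactor n (h j)).comp (-(n : ℚ[X]) - X) =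
      ∏ j ∈ Finset.Icc 1 7, qFactor n (h j) := by
    rw [Polynomial.prod_comp]
    exact Finset.prod_congr rfl fun j hj => qFactor_comp_neg n (h j) (hb j hj).1 (hb j hj).2
  unfold vwpPoly
  rw [mul_comp, hlin, hprod, Odd.neg_one_pow ⟨3 * (n + 1), by ring⟩]
  ring

/-- DEGREE of `P`: `deg P + 2 ≤ 6(n+1)` as soon as `Σ_{j=1}^{7} h_j ≤ 3(n+2)+2` (and `h_j ≥ 1`). -/
theorem natDegree_vwpPoly (n : ℕ) (h : ℕ → ℕ) (hb : ∀ j ∈ Finset.Icc 1 7, 1 ≤ h j ∧ h j ≤ n + 2)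
    (hs : ∑ j ∈ Finset.Icc 1 7, h j ≤ 3 * (n + 2) + 2) : (vwpPoly n h).natDegree + 2 ≤ 6 * (n + 1) := by
  have hdeg : (vwpPoly n h).natDegree ≤ 1 + ∑ j ∈ Finset.Icc 1 7, 2 * (h j - 1) := by
    unfold vwpPoly
    refine Polynomial.natDegree_mul_le.trans (add_le_add natDegree_linear_le ?_)
    exact (Polynomial.natDegree_prod_le _ _).trans (Finset.sum_le_sum fun j _ => natDegree_qFactor_le n (h j))
  rw [sum_Icc_one_seven] at hdeg hs
  have b1 := hb 1 (by simp); have b2 := hb 2 (by simp); have b3 := hb 3 (by simp); have b4 := hb 4 (by simp)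
  have b5 := hb 5 (by simp); have b6 := hb 6 (by simp); have b7 := hb 7 (by simp)
  omega

/-! ### Γ at positive integers: the termwise identity -/

/-- `(μ+s)! · ∏_{i<m} (μ+1+s+i) = (μ+s+m)!`. -/
theorem factorial_mul_prod_range (μ s m : ℕ) :
    (((μ + s).factorial : ℕ) : ℝ) * ∏ i ∈ Finset.range m, ((μ : ℝ) + 1 + ((s + i : ℕ) : ℝ)) =
      (((μ + s + m).factorial : ℕ) : ℝ) := by
  induction m with
  | zero => simp
  | succ m ih =>
    rw [Finset.prod_range_succ, ← mul_assoc, ih, show μ + s + (m + 1) = (μ + s + m) + 1 by ring,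
      Nat.factorial_succ]
    push_cast
    ring

/-- `μ! · (μ+1)_{n+1} = (μ+n+1)!`. -/
theorem factorial_mul_poch (μ n : ℕ) :
    ((μ.factorial : ℕ) : ℝ) * poch (μ + 1) n = (((μ + n + 1).factorial : ℕ) : ℝ) := by
  have h := factorial_mul_prod_range μ 0 (n + 1)
  rw [Nat.add_zero, show μ + (n + 1) = μ + n + 1 by ring] at h
  rw [← h]
  unfold poch
  congr 1
  exact Finset.prod_congr rfl fun i _ => by push_cast; ring

/-- `(μ+1)_{n+1}` as a quotient of factorials. -/
theorem poch_eq_div (μ n : ℕ) :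
    poch (μ + 1) n = (((μ + n + 1).factorial : ℕ) : ℝ) / ((μ.factorial : ℕ) : ℝ) := by
  rw [eq_div_iff (by positivity), mul_comm]
  exact factorial_mul_poch μ n

/-- `(μ+1)_{n+1} ≠ 0`. -/
theorem poch_succ_ne_zero (μ n : ℕ) : poch (μ + 1) n ≠ 0 := by
  rw [poch_eq_div]; positivity

/-- The `j`-th Γ-quotient of the very-well-poised term, `1 ≤ k = h_j ≤ h₀ = n+2`:
`Γ(k+μ)/Γ(1+h₀-k+μ) = Q_k(μ+1)/(μ+1)_{n+1}`. -/
theorem gammaQuot_eq (n k μ : ℕ) (hk1 : 1 ≤ k) (hk2 : k ≤ n + 2) :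
    Real.Gamma ((k : ℝ) + μ) / Real.Gamma (1 + ((n + 2 : ℕ) : ℝ) - k + μ) =
      aeval ((μ : ℝ) + 1) (qFactor n k) / poch (μ + 1) n := by
  obtain ⟨m, rfl⟩ : ∃ m, k = m + 1 := ⟨k - 1, by omega⟩
  have hm : m ≤ n + 1 := by omega
  have e1 : ((m + 1 : ℕ) : ℝ) + μ = (((μ + m : ℕ) : ℝ)) + 1 := by push_cast; ring
  have e2 : 1 + ((n + 2 : ℕ) : ℝ) - ((m + 1 : ℕ) : ℝ) + μ = (((μ + (n + 1 - m) : ℕ) : ℝ)) + 1 := by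
    rw [Nat.cast_add μ, Nat.cast_sub hm]; push_cast; ring
  have hq : qFactor n (m + 1) = risingPoly 0 m * risingPoly (n + 1 - m) m := by
    simp only [qFactor, Nat.add_sub_cancel, show n + 2 - (m + 1) = n + 1 - m by omega]
  rw [e1, e2, Real.Gamma_nat_eq_factorial, Real.Gamma_nat_eq_factorial, hq, map_mul, aeval_risingPoly,
    aeval_risingPoly]
  have f0 : (∏ i ∈ Finset.range m, ((μ : ℝ) + 1 + ((0 + i : ℕ) : ℝ))) =
      (((μ + m).factorial : ℕ) : ℝ) / ((μ.factorial : ℕ) : ℝ) := by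
    rw [eq_div_iff (by positivity), mul_comm]
    have := factorial_mul_prod_range μ 0 m
    simpa using this
  have f1 : (∏ i ∈ Finset.range m, ((μ : ℝ) + 1 + (((n + 1 - m) + i : ℕ) : ℝ))) =
      (((μ + n + 1).factorial : ℕ) : ℝ) / (((μ + (n + 1 - m)).factorial : ℕ) : ℝ) := by
    rw [eq_div_iff (by positivity), mul_comm]
    have := factorial_mul_prod_range μ (n + 1 - m) m
    rw [show μ + (n + 1 - m) + m = μ + n + 1 by omega] at this
    exact this
  rw [f0, f1, poch_eq_div]
  field_simp

/-- The `j = 0` Γ-quotient: `Γ(h₀+μ)/Γ(1+μ) = (μ+1)_{n+1}` (`h₀ = n+2`). -/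
theorem gammaQuot_zero_eq (n μ : ℕ) :
    Real.Gamma (((n + 2 : ℕ) : ℝ) + μ) / Real.Gamma (1 + ((n + 2 : ℕ) : ℝ) - ((n + 2 : ℕ) : ℝ) + μ) =
      poch (μ + 1) n := by
  have e1 : ((n + 2 : ℕ) : ℝ) + μ = (((μ + n + 1 : ℕ) : ℝ)) + 1 := by push_cast; ring
  have e2 : 1 + ((n + 2 : ℕ) : ℝ) - ((n + 2 : ℕ) : ℝ) + μ = ((μ : ℕ) : ℝ) + 1 := by push_cast; ring
  rw [e1, e2, Real.Gamma_nat_eq_factorial, Real.Gamma_nat_eq_factorial, poch_eq_div]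

/-- Evaluation of `P` at `μ+1`. -/
theorem aeval_vwpPoly (n : ℕ) (h : ℕ → ℕ) (μ : ℕ) :
    aeval ((μ : ℝ) + 1) (vwpPoly n h) =
      (2 * ((μ : ℝ) + 1) + n) * ∏ j ∈ Finset.Icc 1 7, aeval ((μ : ℝ) + 1) (qFactor n (h j)) := by
  simp only [vwpPoly, map_mul, map_prod, map_add, Polynomial.aeval_X, Polynomial.aeval_C, eq_ratCast,
    Rat.cast_natCast, Rat.cast_ofNat]

/-- TERMWISE IDENTITY: the `μ`-th term of `vwpSeries 7 h` (`h₀ = n+2`, `1 ≤ h_j ≤ h₀`) is `P(μ+1)/(μ+1)_{n+1}^6`. -/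
theorem vwpTerm_eq (n : ℕ) (h : ℕ → ℕ) (h0 : h 0 = n + 2) (hb : ∀ j ∈ Finset.Icc 1 7, 1 ≤ h j ∧ h j ≤ n + 2)
    (μ : ℕ) :
    (((h 0 : ℕ) : ℝ) + 2 * (μ : ℝ)) *
        (∏ j ∈ Finset.range (7 + 1),
          Real.Gamma (((h j : ℕ) : ℝ) + μ) / Real.Gamma (1 + ((h 0 : ℕ) : ℝ) - ((h j : ℕ) : ℝ) + μ)) *
        (-1 : ℝ) ^ ((7 + 1) * μ) =
      aeval ((μ : ℝ) + 1) (vwpPoly n h) / poch (μ + 1) n ^ 6 := by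
  have hsign : (-1 : ℝ) ^ ((7 + 1) * μ) = 1 := by
    rw [show (7 + 1) * μ = 2 * (4 * μ) by ring, pow_mul]; simp
  rw [hsign, mul_one, prod_range_eight, h0, gammaQuot_zero_eq]
  have hf : ∀ j ∈ Finset.Icc 1 7, Real.Gamma (((h j : ℕ) : ℝ) + μ) /
      Real.Gamma (1 + ((n + 2 : ℕ) : ℝ) - ((h j : ℕ) : ℝ) + μ) = aeval ((μ : ℝ) + 1) (qFactor n (h j)) / poch (μ + 1) n :=
    fun j hj => gammaQuot_eq n (h j) μ (hb j hj).1 (hb j hj).2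
  rw [Finset.prod_congr rfl hf, Finset.prod_div_distrib, Finset.prod_const, Nat.card_Icc, aeval_vwpPoly]
  have hp := poch_succ_ne_zero μ n
  push_cast
  field_simp
  ring

/-- **MAIN THEOREM.** For integers `h₀ ≥ 2`, `1 ≤ h_j ≤ h₀` (`j = 1,…,7`) with `h₁+⋯+h₇ ≤ 3h₀+2`, the very-well-poised
series `F₇(h) = vwpSeries 7 h` is a rational linear form in `1, ζ(3), ζ(5)` (Ball–Rivoal; here a COROLLARY of the tree
theorem `CressonFischlerRivoal2008.theoreme1_holds`). -/
theorem vwpSeries_seven_odd (h : ℕ → ℕ) (h02 : 2 ≤ h 0) (hb : ∀ j ∈ Finset.Icc 1 7, 1 ≤ h j ∧ h j ≤ h 0)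
    (hs : ∑ j ∈ Finset.Icc 1 7, h j ≤ 3 * h 0 + 2) :
    ∃ c : Fin 3 → ℚ, vwpSeries 7 (fun j => ((h j : ℕ) : ℝ)) = c 0 + c 1 * zetaValue 3 + c 2 * zetaValue 5 := by
  obtain ⟨n, hn⟩ : ∃ n, h 0 = n + 2 := ⟨h 0 - 2, by omega⟩
  rw [hn] at hb hs
  obtain ⟨a, ha⟩ := theoreme1_holds n 6 (vwpPoly n h) (by norm_num) (natDegree_vwpPoly n h hb hs)
    (vwpPoly_comp_neg n h hb)
  have hterm := vwpTerm_eq n h hn hb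
  refine ⟨![a 0, a 3, a 5], ?_⟩
  rw [show vwpSeries 7 (fun j => ((h j : ℕ) : ℝ)) = ∑' μ : ℕ, (((h 0 : ℕ) : ℝ) + 2 * (μ : ℝ)) *
        (∏ j ∈ Finset.range (7 + 1),
          Real.Gamma (((h j : ℕ) : ℝ) + μ) / Real.Gamma (1 + ((h 0 : ℕ) : ℝ) - ((h j : ℕ) : ℝ) + μ)) *
        (-1 : ℝ) ^ ((7 + 1) * μ) from rfl, tsum_congr hterm, ha.tsum_eq]
  have hset : (Finset.Icc 3 6).filter Odd = {3, 5} := by decide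
  rw [hset, Finset.sum_pair (by norm_num)]
  simp only [Matrix.cons_val_zero, Matrix.cons_val_one, Matrix.head_cons, Matrix.cons_val_two, Matrix.tail_cons]
  ring

end Summit.KontsevichZagierPeriods.Zeta5Search.SorokinCensus
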